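import Mathlib
import Literature.MathematicalPhysics.QuantumFieldTheory.Balaban1983to89.B5Hk103Minimizer

/-!
# Bałaban [B5] (1.64)–(1.65) — the action `⟨B, Δ_kB⟩ = ⟨∂H_kB, ∂H_kB⟩` of the SCALAR whole-lattice `H`:
# the minimal energy as the explicit coarse quadratic form `(Q'G'Q'*)⁻¹ − a`, its positivity and `a`-independence

**Sources (verbatim; the quotations LOCATE the object — nothing printed is used as a hypothesis).**

* [B5] T. Bałaban, *Propagators and renormalization transformations for lattice gauge theories. I*, Commun. Math.
  Phys. **95** (1984) 17–40 [`Balaban1984PropagatorsI`], p. 29 [PDF 13] (render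
  `1984-cmp95-propagators-rt-I-p013-x2.png`, read as an image by this unit): «Let us now come back to the integral
  (1.47). We make the translation A = A′ + H_kB and using the above properties of H_kB, we get
  ((ST)^k e^{−S})(B) = Z_k exp(−½⟨∂H_kB, ∂H_kB⟩). (1.64)  The action Δ_k is thus defined by
  ⟨B, Δ_kB⟩ = ⟨∂H_kB, ∂H_kB⟩. (1.65)»; same page, before: «H_kB is a minimum of ½⟨∂A, ∂A⟩ on the hyperplane
  {A : Q_kA = B, R∂*A = 0}»; the representation `H_kB = GQ*(QGQ*)⁻¹B` is (1.103) p. 34 [PDF 18].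

**What this module proves (KERNEL, hypothesis-free; scalar case `U = 1`; site coordinates on `ℤ^d`, mesh
`η = 1/(n+1)` with `n : ℕ` ARBITRARY, `a > 0`; `B` finitely supported in a finset `T`, `HB = Σ_{y∈T} B(y)H(·,y)` as
in `B5Hk103Minimizer`).**

* `energy_HB_eq` — THE VALUE OF THE MINIMUM as an explicit coarse-lattice quadratic form:
  `energy HB = ((n+1)^d/(n+1)^2) · actionForm`, `actionForm = Σ_{y'',y∈T} B(y'')B(y)·((Q'G'Q'*)⁻¹(y'',y) − a·δ_{y''y})`
  (`(Q'G'Q'*)⁻¹ = B5Hk103ScalarZd.Kinv`); mechanism: `energy HB = ⟨(−Δ)HB, HB⟩` (`B5Hk103Unique.tsum_lapRow_mul_self`),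
  `(−Δ)HB` is block-constant with value `Σ_y B(y)((Q'G'Q'*)⁻¹(blk, y) − aδ)/(n+1)²` (`B5Hk103Minimizer.lapRow_HB`,
  the Euler–Lagrange identity of `B5Hk103ScalarZd.tsum_lap_mul_kerH`), and `Q'(HB) = B` block by block;
* `actionForm_nonneg` and, for `d ≥ 1`, POSITIVE DEFINITENESS `eq_zero_of_actionForm_eq_zero` (a zero action forces
  `B = 0`: zero energy makes the square-summable `HB` shift-invariant, hence `0`, and `B = Q'(HB)`);
* `actionKer_indep` — the kernel `(Q'G'_aQ'*)⁻¹(y'',y) − a·δ_{y''y}` does NOT depend on `a`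
  (from `B5Hk103Unique.kerH_eq_kerH`), hence `actionForm_indep`.

DICTIONARY (honest, as in the parent modules): the print's scalar product on the `η`-lattice carries the weight
`η^d` and `∂^η = η⁻¹∇`, so `⟨∂A, ∂A⟩ = η^{d−2}·energy A = (n+1)^{2−d}·energy A` in our site units; thus
`energy_HB_eq` reads `⟨∂HB, ∂HB⟩ = Σ_{y'',y} B(y'')B(y)((Q'G'Q'*)⁻¹(y'',y) − aδ_{y''y})`, i.e. the SCALAR
WHOLE-LATTICE analogue of (1.65) with `Δ_k^{scalar} = (Q'G'Q'*)⁻¹ − a` on finitely supported `B`.  RELATION TO THE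
TREE: the TORUS / VECTOR (axial-gauge, typed-operator) identity `Δ_k = (QGQ*)⁻¹ − a·1` with the genuine printed
objects is `Beta.BlockEffectiveAction.DelK_eq` (β sub-cell, an5 lineage) — NOT imported here (different objects);
the present module is the infinite-volume (`ℤ^d`, (P1-K) column) scalar counterpart over `B5Hk103ScalarZd.Kinv`.

HONEST SCOPE.  (i) SCALAR analogue only (no gauge condition, plain block averaging); (ii) WHOLE lattice `ℤ^d`,
not the torus; (iii) `B` finitely supported (the form is stated as a finite double sum over the support);
(iv) the momentum formula (1.66) and the bounds (1.67) `γ₀⟨∂₁B, ∂₁B⟩ ≤ ⟨B, Δ_kB⟩ ≤ γ₁⟨∂₁B, ∂₁B⟩` are NOT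
treated here (nonnegativity and definiteness only).

ABSOLUTE-RULE CENSUS: every theorem below is proved outright from the tree modules `B5Hk103Minimizer`,
`B5Hk103Unique`, `B5Hk103ScalarZd` (and through them `B6QGQDecay237`, `B6QGQLower276`) and Mathlib (sorry-free;
axioms `propext`, `Classical.choice`, `Quot.sound` only); no quoted statement is used as a hypothesis.  Unit
`b2b-balaban-pv23-g7` (surge node prover #23, gen 7; journal claim B5-165-ACTION-SCALAR-ZD); value = kernel
discharge (scalar, infinite volume), NOT summit progress.
-/

namespace Literature.MathematicalPhysics.QuantumFieldTheory.Balaban1983to89.B5Hk165ActionZd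

open Finset Real Filter Topology
open B6QGQLower276 B6QGQDecay237 B5Hk103ScalarZd B5Hk103Unique B5Hk103Minimizer

noncomputable section

variable {d : ℕ}

/-! ## §1  The coarse action kernel and form [folklore dictionary; print-located] -/

/-- The scalar coarse ACTION KERNEL `Δ^{scalar}(y'',y) = (Q'G'Q'*)⁻¹(y'',y) − a·δ_{y''y}` (site/`η` bookkeeping in
the module docstring). [cite: Balaban1984PropagatorsI, (1.65) p.29] -/
def actionKer (n : ℕ) (a : ℝ) (y'' y : X d) : ℝ := Kinv n a y'' y - a * (if y'' = y then 1 else 0)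

/-- The coarse ACTION FORM of a field `B` supported in `T`: `Σ_{y'',y∈T} B(y'')B(y)Δ^{scalar}(y'',y)`.
[cite: Balaban1984PropagatorsI, (1.65) p.29] -/
def actionForm (n : ℕ) (a : ℝ) (T : Finset (X d)) (Bf : X d → ℝ) : ℝ :=
  ∑ y'' ∈ T, ∑ y ∈ T, Bf y'' * Bf y * actionKer n a y'' y

/-! ## §2  The value of the minimum: `⟨∂HB, ∂HB⟩` as the coarse form [print-located; proved outright] -/

/-- Block sums of `((−Δ)HB)·HB`: on the block `B(y'')`, `(−Δ)HB` is the constant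
`Σ_y B(y)Δ^{scalar}(y'',y)/(n+1)²` and `Σ_{B(y'')} HB = (n+1)^d B(y'')`. [folklore] -/
theorem sum_B_lapRow_HB_mul (n : ℕ) {a : ℝ} (ha : 0 < a) (T : Finset (X d)) (Bf : X d → ℝ)
    (hT : ∀ y ∉ T, Bf y = 0) (y'' : X d) :
    ∑ q ∈ B n y'', lapRow (HB n a T Bf) q * HB n a T Bf q =
      (∑ y ∈ T, Bf y * (actionKer n a y'' y / ((n : ℝ) + 1) ^ 2)) * (((n : ℝ) + 1) ^ d * Bf y'') := by
  classical
  rw [← sum_B_HB n ha T Bf hT y'', Finset.mul_sum]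
  refine Finset.sum_congr rfl fun q hq => ?_
  rw [lapRow_HB n ha T Bf q, mem_B.1 hq]
  rfl

/-- **(1.65), scalar, `ℤ^d` — the energy of the minimiser is the coarse action form**:
`energy HB = ((n+1)^d/(n+1)^2)·Σ_{y'',y∈T} B(y'')B(y)((Q'G'Q'*)⁻¹(y'',y) − aδ_{y''y})`.
[cite: Balaban1984PropagatorsI, (1.65) p.29] -/
theorem energy_HB_eq (n : ℕ) {a : ℝ} (ha : 0 < a) (T : Finset (X d)) (Bf : X d → ℝ) (hT : ∀ y ∉ T, Bf y = 0) :
    energy (HB n a T Bf) = ((n : ℝ) + 1) ^ d / ((n : ℝ) + 1) ^ 2 * actionForm n a T Bf := by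
  classical
  have h2 := summable_HB_sq n ha T Bf
  have hE : energy (HB n a T Bf) = ∑' p, lapRow (HB n a T Bf) p * HB n a T Bf p := by
    rw [tsum_lapRow_mul_self h2]; rfl
  rw [hE, ← tsum_blocks n (summable_lapRow_mul₂ h2 h2)]
  simp only [sum_B_lapRow_HB_mul n ha T Bf hT]
  rw [tsum_eq_sum (s := T) fun y'' hy'' => by rw [hT y'' hy'', mul_zero, mul_zero]]
  rw [actionForm, Finset.mul_sum]
  refine Finset.sum_congr rfl fun y'' _ => ?_
  rw [Finset.sum_mul, Finset.mul_sum]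
  refine Finset.sum_congr rfl fun y _ => ?_
  ring

/-- The same identity with the print's normalisation made explicit: `(n+1)^2·energy HB = (n+1)^d·actionForm`
(no division). [folklore] -/
theorem energy_HB_eq' (n : ℕ) {a : ℝ} (ha : 0 < a) (T : Finset (X d)) (Bf : X d → ℝ) (hT : ∀ y ∉ T, Bf y = 0) :
    ((n : ℝ) + 1) ^ 2 * energy (HB n a T Bf) = ((n : ℝ) + 1) ^ d * actionForm n a T Bf := by
  have hc : ((n : ℝ) + 1) ^ 2 ≠ 0 := by positivity
  rw [energy_HB_eq n ha T Bf hT]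
  field_simp

/-! ## §3  Positivity and definiteness of the action form [folklore] -/

/-- `Δ^{scalar} ≥ 0` on finitely supported fields: `0 ≤ actionForm`. [cite: Balaban1984PropagatorsI, (1.65) p.29] -/
theorem actionForm_nonneg (n : ℕ) {a : ℝ} (ha : 0 < a) (T : Finset (X d)) (Bf : X d → ℝ)
    (hT : ∀ y ∉ T, Bf y = 0) : 0 ≤ actionForm n a T Bf := by
  have h := energy_HB_eq' n ha T Bf hT
  have hE : 0 ≤ energy (HB n a T Bf) := Finset.sum_nonneg fun μ _ => tsum_nonneg fun p => sq_nonneg _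
  have hd : (0 : ℝ) < ((n : ℝ) + 1) ^ d := by positivity
  have h2 : (0 : ℝ) ≤ ((n : ℝ) + 1) ^ 2 := by positivity
  nlinarith

/-- Zero energy forces invariance under every unit shift (square-summable fields). [folklore] -/
theorem shift_eq_of_energy_eq_zero {D : X d → ℝ} (hD2 : Summable fun p => D p ^ 2) (hE : energy D = 0)
    (μ : Fin d) (q : X d) : D (q + e μ) = D q := by
  have hμ : ∑' q, (D q - D (q + e μ)) ^ 2 = 0 :=
    (Finset.sum_eq_zero_iff_of_nonneg fun ν _ => tsum_nonneg fun q => sq_nonneg _).1 hE μ (Finset.mem_univ μ)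
  by_contra hne
  have hpos : 0 < (D q - D (q + e μ)) ^ 2 := by
    have : D q - D (q + e μ) ≠ 0 := sub_ne_zero.2 (Ne.symm hne)
    positivity
  have := (summable_grad_sq hD2 μ).tsum_pos (fun q => sq_nonneg _) q hpos
  linarith

/-- In dimension `d ≥ 1`, a square-summable field invariant under every unit shift vanishes (square-summable
families tend to `0` along the injective orbit `k ↦ p + k•e_0`). [folklore] -/
theorem eq_zero_of_shift_eq_pos (hd : 0 < d) {D : X d → ℝ} (hD2 : Summable fun p => D p ^ 2)
    (hshift : ∀ (μ : Fin d) (p : X d), D (p + e μ) = D p) (p : X d) : D p = 0 := by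
  set μ₀ : Fin d := ⟨0, hd⟩
  set orb : ℕ → X d := fun k => p + (k : ℤ) • e μ₀ with horb
  have hconst : ∀ k : ℕ, D (orb k) = D p := by
    intro k
    induction k with
    | zero => simp [horb]
    | succ k ih =>
      have : orb (k + 1) = orb k + e μ₀ := by
        simp only [horb]; push_cast; rw [add_smul, one_smul, add_assoc]
      rw [this, hshift μ₀ (orb k), ih]
  have hinj : Function.Injective orb := by
    intro k₁ k₂ hk
    have := congr_fun hk μ₀
    simp only [horb, Pi.add_apply, Pi.smul_apply, e, Pi.single_eq_same, smul_eq_mul, mul_one,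
      add_right_inj] at this
    exact_mod_cast this
  have ht : Tendsto (fun k => D (orb k) ^ 2) cofinite (𝓝 0) :=
    hD2.tendsto_cofinite_zero.comp hinj.tendsto_cofinite
  simp only [hconst] at ht
  exact pow_eq_zero_iff (n := 2) (by norm_num) |>.1 (tendsto_const_nhds_iff.1 ht)

/-- In dimension `d ≥ 1`, zero energy of `HB` forces `HB = 0`. [folklore] -/
theorem HB_eq_zero_of_energy_eq_zero (hd : 0 < d) (n : ℕ) {a : ℝ} (ha : 0 < a) (T : Finset (X d))
    (Bf : X d → ℝ) (hE : energy (HB n a T Bf) = 0) (p : X d) : HB n a T Bf p = 0 :=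
  eq_zero_of_shift_eq_pos hd (summable_HB_sq n ha T Bf)
    (shift_eq_of_energy_eq_zero (summable_HB_sq n ha T Bf) hE) p

/-- **POSITIVE DEFINITENESS (`d ≥ 1`)**: a finitely supported `B` with zero action vanishes
(`B = Q'(HB)` and `HB = 0`). [cite: Balaban1984PropagatorsI, (1.65) p.29] -/
theorem eq_zero_of_actionForm_eq_zero (hd : 0 < d) (n : ℕ) {a : ℝ} (ha : 0 < a) (T : Finset (X d))
    (Bf : X d → ℝ) (hT : ∀ y ∉ T, Bf y = 0) (h0 : actionForm n a T Bf = 0) (y'' : X d) : Bf y'' = 0 := by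
  have hc2 : (0 : ℝ) < ((n : ℝ) + 1) ^ 2 := by positivity
  have hcd : ((n : ℝ) + 1) ^ d ≠ 0 := by positivity
  have hE : energy (HB n a T Bf) = 0 := by
    have h := energy_HB_eq' n ha T Bf hT
    rw [h0, mul_zero] at h
    exact (mul_eq_zero.1 h).resolve_left hc2.ne'
  have hsum := sum_B_HB n ha T Bf hT y''
  rw [Finset.sum_eq_zero fun p _ => HB_eq_zero_of_energy_eq_zero hd n ha T Bf hE p] at hsum
  exact (mul_eq_zero.1 hsum.symm).resolve_left hcd

/-- Strict positivity (`d ≥ 1`): a finitely supported `B ≠ 0` has strictly positive action. [folklore] -/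
theorem actionForm_pos (hd : 0 < d) (n : ℕ) {a : ℝ} (ha : 0 < a) (T : Finset (X d)) (Bf : X d → ℝ)
    (hT : ∀ y ∉ T, Bf y = 0) {y₀ : X d} (hy₀ : Bf y₀ ≠ 0) : 0 < actionForm n a T Bf :=
  lt_of_le_of_ne (actionForm_nonneg n ha T Bf hT)
    fun h => hy₀ (eq_zero_of_actionForm_eq_zero hd n ha T Bf hT h.symm y₀)

/-! ## §4  `a`-independence of the action kernel [folklore; cf. the torus statement `DelK_indep` of the β cell] -/

/-- **The action kernel does not depend on `a`**: `(Q'G'_aQ'*)⁻¹(y'',y) − aδ_{y''y} = (Q'G'_{a'}Q'*)⁻¹(y'',y) − a'δ_{y''y}`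
(both equal `(n+1)²·((−Δ)H(·,y))` on the block `y''`, and `H` is `a`-independent by `B5Hk103Unique.kerH_eq_kerH`).
[cite: Balaban1984PropagatorsI, (1.65) p.29] -/
theorem actionKer_indep (n : ℕ) {a a' : ℝ} (ha : 0 < a) (ha' : 0 < a') (y'' y : X d) :
    actionKer n a y'' y = actionKer n a' y'' y := by
  have hc : ((n : ℝ) + 1) ^ 2 ≠ 0 := by positivity
  have h1 := lapRow_kerH n ha (chart n y'' fun _ => 0) y
  have h2 := lapRow_kerH n ha' (chart n y'' fun _ => 0) y
  rw [blk_chart] at h1 h2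
  rw [kerH_eq_kerH n ha ha', h2] at h1
  exact ((div_left_inj' hc).1 h1).symm

/-- Hence the action form does not depend on `a`. [folklore] -/
theorem actionForm_indep (n : ℕ) {a a' : ℝ} (ha : 0 < a) (ha' : 0 < a') (T : Finset (X d)) (Bf : X d → ℝ) :
    actionForm n a T Bf = actionForm n a' T Bf := by
  unfold actionForm
  simp_rw [actionKer_indep n ha ha']

/-- And the minimal energy does not depend on `a` either (also immediate from `kerH_eq_kerH`). [folklore] -/
theorem energy_HB_indep (n : ℕ) {a a' : ℝ} (ha : 0 < a) (ha' : 0 < a') (T : Finset (X d)) (Bf : X d → ℝ) :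
    energy (HB n a T Bf) = energy (HB n a' T Bf) := by
  have : HB (d := d) n a T Bf = HB n a' T Bf := by
    funext p; simp only [HB, kerH_eq_kerH n ha ha']
  rw [this]

/-! ## §5  The point source: the diagonal of the action kernel [folklore] -/

/-- For `B = δ_y`: `energy H(·,y) = ((n+1)^d/(n+1)^2)·((Q'G'Q'*)⁻¹(y,y) − a)`, so in particular
`a ≤ (Q'G'Q'*)⁻¹(y,y)` (cf. the printed `QGQ* ≤ a⁻¹I`, (1.100) p.34, on the diagonal). [folklore] -/
theorem energy_kerH_col_eq (n : ℕ) {a : ℝ} (ha : 0 < a) (y : X d) :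
    energy (fun p => kerH n a p y) = ((n : ℝ) + 1) ^ d / ((n : ℝ) + 1) ^ 2 * (Kinv n a y y - a) := by
  classical
  have hT : ∀ y' ∉ ({y} : Finset (X d)), (fun y' : X d => if y' = y then (1 : ℝ) else 0) y' = 0 := by
    intro y' hy'
    simp only [Finset.mem_singleton] at hy'
    simp [hy']
  have hHB : HB n a {y} (fun y' => if y' = y then (1 : ℝ) else 0) = fun p => kerH n a p y := by
    funext p; simp [HB]
  have h := energy_HB_eq n ha {y} (fun y' => if y' = y then (1 : ℝ) else 0) hT
  rw [hHB] at h
  rw [h, actionForm]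
  simp [actionKer]

/-- The diagonal lower bound `a ≤ (Q'G'Q'*)⁻¹(y,y)`. [folklore] -/
theorem le_Kinv_diag (n : ℕ) {a : ℝ} (ha : 0 < a) (y : X d) : a ≤ Kinv n a y y := by
  have h := energy_kerH_col_eq n ha y
  have hE : 0 ≤ energy (fun p => kerH n a p y) := Finset.sum_nonneg fun μ _ => tsum_nonneg fun p => sq_nonneg _
  have hc : (0 : ℝ) < ((n : ℝ) + 1) ^ d / ((n : ℝ) + 1) ^ 2 := by positivity
  rw [h] at hE
  nlinarith [(mul_nonneg_iff_of_pos_left hc).1 hE]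

end

end Literature.MathematicalPhysics.QuantumFieldTheory.Balaban1983to89.B5Hk165ActionZd
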